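import Summits.NavierStokesRegularity.NavierStokesRegularity.Theses.ExtremalTypeIConstant
import Summits.NavierStokesRegularity.NavierStokesRegularity.Theorems.SqueezeCycleExtremalElementExistsExtraction
import Summits.NavierStokesRegularity.NavierStokesRegularity.Theorems.SqueezeCycleExtremalBiaxialitySubcriticalSmallConstant
import Summits.NavierStokesRegularity.NavierStokesRegularity.Theorems.SymmetryModuliCountFarPastLedgerReduction
import HarnessLib

/-!
# Route `ExtremalTypeIConstant`, support item `MinimiserExists` (stmt-NavierStokesRegularity-8217)

Attainment of the extremal Type-I constant over the KNSS Oseen-gauge ancient class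
`A_C = IsTypeIAncientMild C` (Koch–Nadirashvili–Seregin–Šverák 2009, §6): if some `A_C` has a
nontrivial element, then there is an EXTREMAL pair `(C⋆, w)` — `w ∈ A_{C⋆}`, `0 < C⋆ = ‖w(−1, 0)‖`,
and `C⋆ ≤ C'` whenever `A_{C'}` has a nontrivial element.

Proof (all analytic inputs are theorems of the tree).
* `C⋆ := inf {C' | A_{C'} has a nontrivial element}`; the small-constant Liouville theorem
  `exists_typeIAncientMild_eq_zero_of_small` (Leray's rate / KNSS §4 bilinear bound) gives a
  universal `ε > 0` below every such `C'`, so `0 < ε ≤ C⋆`.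
* Minimising sequence `u_k ∈ A_{C_k}`, `C⋆ ≤ C_k < C⋆ + 1/(k+1)`, nontrivial; by minimality of `C⋆`
  there are points `(t_k, x_k)`, `t_k < 0`, with `√(−t_k)‖u_k(t_k, x_k)‖ > C⋆ − 1/(k+1)` (otherwise
  `u_k ∈ A_{C⋆ − 1/(k+1)}`).
* Renormalise by the symmetries of the class (`isTypeIAncientMild_translate`,
  `isTypeIAncientMild_nsRescale`): `v_k(s, y) = λ_k u_k(λ_k² s, x_k + λ_k y)`, `λ_k = √(−t_k)`, so that
  `v_k ∈ A_{C_k} ⊆ A_{C⋆+1}` and `‖v_k(−1, 0)‖ = √(−t_k)‖u_k(t_k, x_k)‖ ∈ (C⋆ − 1/(k+1), C_k]`.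
* Compactness of `A_{C⋆+1}` (`exists_tendsto_of_isTypeIAncientMild_seq`: KNSS Prop. 4.1 bounds,
  Arzelà–Ascoli, dominated convergence in the Oseen equation, KNSS Lemma 6.1): a subsequence
  converges pointwise on the open slab to some `W ∈ A_{C⋆+1}`; pointwise limits give
  `‖W(t, x)‖ ≤ C⋆/√(−t)` and `‖W(−1, 0)‖ = C⋆`.
-/

noncomputable section

namespace Summit.NavierStokesRegularity.NavierStokesRegularity.Theorems

open MeasureTheory Set Function Filter Topology
open Literature.Analysis Literature.Analysis.FluidPDE

/-- The value of the renormalised field `v(s, y) = λ u(λ² s, x₀ + λ y)`, `λ = √(−t₀)`, at the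
marked point: `‖v(−1, 0)‖ = √(−t₀) ‖u(t₀, x₀)‖` (`t₀ < 0`). [folklore] -/
theorem extremalTypeIConstant_norm_nsRescale_translate_negOne {t₀ : ℝ} (ht₀ : t₀ < 0)
    (u : ℝ → EuclideanSpace ℝ (Fin 3) → EuclideanSpace ℝ (Fin 3)) (x₀ : EuclideanSpace ℝ (Fin 3)) :
    ‖nsRescale (Real.sqrt (-t₀)) (fun t x => u t (x₀ + x)) (-1) 0‖ =
      Real.sqrt (-t₀) * ‖u t₀ x₀‖ := by
  rw [nsRescale_apply, smul_zero, add_zero, mul_neg_one, Real.sq_sqrt (neg_nonneg.2 ht₀.le),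
    neg_neg, norm_smul, Real.norm_of_nonneg (Real.sqrt_nonneg _)]

open Summit.NavierStokesRegularity.NavierStokesRegularity.Theses.ExtremalTypeIConstant in
/-- **`MinimiserExists` (route `ExtremalTypeIConstant`, item stmt-NavierStokesRegularity-8217).**
If some class `A_C` of smooth divergence-free KNSS-mild ancient fields with `‖u‖ ≤ C/√(−t)`
contains a nontrivial element, then the least such constant `C⋆` is positive and ATTAINED: there
is `w ∈ A_{C⋆}` with `‖w(−1, 0)‖ = C⋆`, and `C⋆ ≤ C'` whenever `A_{C'}` has a nontrivial element
(gap `exists_typeIAncientMild_eq_zero_of_small`; minimising sequence renormalised by translation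
and parabolic scaling to the hot spot `(−1, 0)`; compactness of the class
`exists_tendsto_of_isTypeIAncientMild_seq`; see the module docstring).
[cite: KochNadirashviliSereginSverak2009, §6 Lemma 6.1 and Prop. 4.1 (arXiv:0709.3599 pp. 8, 11)] -/
theorem extremalTypeIConstant_minimiserExists_proof : MinimiserExists := by
  rintro ⟨C₀, u₀, hu₀, hne₀⟩
  -- ## the set of admissible constants of nontrivial elements and its infimum
  set S : Set ℝ := {C' | ∃ u' : ℝ → EuclideanSpace ℝ (Fin 3) → EuclideanSpace ℝ (Fin 3),
    IsTypeIAncientMild C' u' ∧ ∃ t < 0, ∃ x, u' t x ≠ 0} with hS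
  have hmem : ∀ {C' : ℝ} {u' : ℝ → EuclideanSpace ℝ (Fin 3) → EuclideanSpace ℝ (Fin 3)},
      IsTypeIAncientMild C' u' → (∃ t < 0, ∃ x, u' t x ≠ 0) → C' ∈ S :=
    fun hu' hne' => ⟨_, hu', hne'⟩
  have hSne : S.Nonempty := ⟨C₀, hmem (isTypeIAncientMild_iff.2 hu₀) hne₀⟩
  obtain ⟨ε, hε, hsmall⟩ := exists_typeIAncientMild_eq_zero_of_small
  have hSε : ∀ C' ∈ S, ε < C' := by
    rintro C' ⟨u', hu', t, ht, x, hx⟩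
    by_contra hle
    push Not at hle
    exact hx (hsmall C' u' hu' hle t ht x)
  have hSbdd : BddBelow S := ⟨ε, fun C' hC' => (hSε C' hC').le⟩
  set Cs : ℝ := sInf S with hCs
  have hεCs : ε ≤ Cs := le_csInf hSne fun C' hC' => (hSε C' hC').le
  have hCs0 : 0 < Cs := hε.trans_le hεCs
  have hCsle : ∀ C' ∈ S, Cs ≤ C' := fun C' hC' => csInf_le hSbdd hC'
  -- ## a minimising sequence of nontrivial elements
  have hδpos : ∀ k : ℕ, (0 : ℝ) < 1 / ((k : ℝ) + 1) := fun k => by positivity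
  have hseq : ∀ k : ℕ, ∃ C' ∈ S, C' < Cs + 1 / ((k : ℝ) + 1) := fun k =>
    exists_lt_of_csInf_lt hSne (by linarith [hδpos k])
  choose Ck hCkS hCklt using hseq
  have hCkge : ∀ k, Cs ≤ Ck k := fun k => hCsle _ (hCkS k)
  have hCkS' : ∀ k, ∃ u' : ℝ → EuclideanSpace ℝ (Fin 3) → EuclideanSpace ℝ (Fin 3),
      IsTypeIAncientMild (Ck k) u' ∧ ∃ t < 0, ∃ x, u' t x ≠ 0 := fun k => hCkS k
  choose uk huk hukne using hCkS'
  -- near-maximal points: otherwise `u_k ∈ A_{C⋆ − 1/(k+1)}`, against the minimality of `C⋆`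
  have hpts : ∀ k : ℕ, ∃ t < 0, ∃ x : EuclideanSpace ℝ (Fin 3),
      Cs - 1 / ((k : ℝ) + 1) < Real.sqrt (-t) * ‖uk k t x‖ := by
    intro k
    by_contra h
    push Not at h
    have hmemk : Cs - 1 / ((k : ℝ) + 1) ∈ S := by
      refine hmem ⟨(huk k).1, (huk k).2.1, (huk k).2.2.1, fun t ht x => ?_⟩ (hukne k)
      rw [le_div_iff₀ (Real.sqrt_pos.2 (neg_pos.2 ht)), mul_comm]
      exact h t ht x
    linarith [hCsle _ hmemk, hδpos k]
  choose tk htk xk hxk using hpts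
  -- ## renormalisation to the hot spot `(−1, 0)`
  set vk : ℕ → ℝ → EuclideanSpace ℝ (Fin 3) → EuclideanSpace ℝ (Fin 3) := fun k =>
    nsRescale (Real.sqrt (-tk k)) (fun t x => uk k t (xk k + x)) with hvk_def
  have hvk : ∀ k, IsTypeIAncientMild (Ck k) (vk k) := fun k =>
    isTypeIAncientMild_nsRescale (isTypeIAncientMild_translate (huk k) (xk k))
      (Real.sqrt_pos.2 (neg_pos.2 (htk k)))
  -- a common constant: `A_{C_k} ⊆ A_{C⋆ + 1}` (only the Type-I bound involves the constant)
  have hCk1 : ∀ k : ℕ, Ck k ≤ Cs + 1 := fun k => by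
    have h1 : 1 / ((k : ℝ) + 1) ≤ 1 := by
      rw [div_le_one (by positivity)]; linarith [(k.cast_nonneg : (0 : ℝ) ≤ k)]
    linarith [hCklt k]
  have hvk' : ∀ k, IsTypeIAncientMild (Cs + 1) (vk k) := fun k =>
    ⟨(hvk k).1, (hvk k).2.1, (hvk k).2.2.1, fun t ht x =>
      ((hvk k).norm_le ht x).trans (div_le_div_of_nonneg_right (hCk1 k) (Real.sqrt_nonneg _))⟩
  have hval : ∀ k, ‖vk k (-1) 0‖ = Real.sqrt (-tk k) * ‖uk k (tk k) (xk k)‖ := fun k =>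
    extremalTypeIConstant_norm_nsRescale_translate_negOne (htk k) (uk k) (xk k)
  have hlow : ∀ k : ℕ, Cs - 1 / ((k : ℝ) + 1) < ‖vk k (-1) 0‖ := fun k => by
    rw [hval k]; exact hxk k
  have hup : ∀ k, ‖vk k (-1) 0‖ ≤ Ck k := fun k => by
    have h := (hvk k).norm_le (t := -1) (by norm_num) 0
    rwa [neg_neg, Real.sqrt_one, div_one] at h
  -- ## compactness of the class `A_{C⋆ + 1}`
  obtain ⟨φ, hφ, W, hW, hpt, -, -, -⟩ := exists_tendsto_of_isTypeIAncientMild_seq (Cs + 1) hvk'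
  have hφt : Tendsto φ atTop atTop := hφ.tendsto_atTop
  have hδ : Tendsto (fun j => 1 / (((φ j : ℕ) : ℝ) + 1)) atTop (𝓝 0) :=
    (tendsto_one_div_add_atTop_nhds_zero_nat (𝕜 := ℝ)).comp hφt
  -- `C_{φ j} → C⋆`
  have hCφ : Tendsto (fun j => Ck (φ j)) atTop (𝓝 Cs) := by
    have hupper : Tendsto (fun j => Cs + 1 / (((φ j : ℕ) : ℝ) + 1)) atTop (𝓝 Cs) := by
      simpa using tendsto_const_nhds.add hδ
    exact tendsto_of_tendsto_of_tendsto_of_le_of_le tendsto_const_nhds hupper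
      (fun j => hCkge (φ j)) (fun j => (hCklt (φ j)).le)
  -- ## the limit: Type-I bound with the sharp constant, and the attained value
  have hWI : HasTypeITimeDecay Cs W := fun t ht x =>
    le_of_tendsto_of_tendsto' (hpt t ht x).norm (hCφ.div_const (Real.sqrt (-t)))
      fun j => (hvk (φ j)).norm_le ht x
  have hWs : IsTypeIAncientMild Cs W := ⟨hW.1, hW.2.1, hW.2.2.1, hWI⟩
  have hnorm : ‖W (-1) 0‖ = Cs := by
    have hlower : Tendsto (fun j => Cs - 1 / (((φ j : ℕ) : ℝ) + 1)) atTop (𝓝 Cs) := by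
      simpa using tendsto_const_nhds.sub hδ
    have hsq : Tendsto (fun j => ‖vk (φ j) (-1) 0‖) atTop (𝓝 Cs) :=
      tendsto_of_tendsto_of_tendsto_of_le_of_le hlower hCφ (fun j => (hlow (φ j)).le)
        (fun j => hup (φ j))
    exact tendsto_nhds_unique ((hpt (-1) (by norm_num) 0).norm) hsq
  -- ## conclusion
  refine ⟨Cs, W, hCs0, isTypeIAncientMild_iff.1 hWs, hnorm, fun C' u' hu' hne' => ?_⟩
  exact hCsle C' (hmem (isTypeIAncientMild_iff.2 hu') hne')

end Summit.NavierStokesRegularity.NavierStokesRegularity.Theorems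

end
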